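import Literature.NumberTheory.PAdicHodge.TateAlmostEtalePrincipalUnitRoots
import Mathlib.FieldTheory.Finite.Basic
import HarnessLib

/-!
# Units of a finite extension of `ℚ_p` inside `F̄`: a uniform exponent prime to `p` with
# `u^N ≡ 1 (mod 𝔪)`, and Teichmüller representatives (toward the tame structure theorem / (TS1))

Notation of the tree's `PAdicHodge` files (`K₀ = PadicBase F p hp ≅ ℚ_p ⊆ M ⊆ F̄ = NormedAlgClosure F`,
`q = ‖p‖ < 1`). For an intermediate field `M` FINITE over `K₀` (`n = [M : K₀]`) we prove, without
residue fields:

* `TateAlmostEtale.norm_sub_one_lt_one_of_pow_prime_pow` : for `‖x‖ ≤ 1`, `‖x^{p^a} - 1‖ < 1 ⇒ ‖x - 1‖ < 1`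
  (the residue ring has characteristic `p`: `(x - 1)^p ≡ x^p - 1 (mod p)`);
* `TateAlmostEtale.exists_pow_sub_one_norm_le_of_norm_eq_one` : every unit `u ∈ M` has
  `‖u^{N₀} - 1‖ ≤ ‖p‖` for some `0 < N₀ ≤ p^n` — the minimal polynomial `g ∈ ℤ_p[X]` of `u` reduces to
  `ḡ ∈ 𝔽_p[X]` of degree `k ≤ n`, and in the finite ring `𝔽_p[X]/(ḡ)` (of order `p^k`) two of the powers
  `x^0, …, x^{p^k}` of the class of `X` coincide, so `ḡ ∣ X^i (X^{N₀} - 1)`; lifting to `ℤ_p[X]` and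
  evaluating at `u` gives `u^i (u^{N₀} - 1) ∈ p ℤ_p[u]`;
* `TateAlmostEtale.exists_uniform_exponent` : **a uniform `N = N(p, n) > 0`, `p ∤ N`, with
  `‖u^N - 1‖ < 1` for every unit `u` of `M`** (strip the `p`-part of `N₀` and take the product of all
  candidates `≤ p^n` prime to `p`) — the residue field of `M` is a finite field of characteristic `p`;
* `TateAlmostEtale.exists_teichmuller` : **Teichmüller representatives** — with that `N`, every unit
  `u ∈ M` is within distance `< 1` of a root of unity `ω ∈ M`, `ω^N = 1` (by the Hensel-free lifting
  `exists_rootOfUnity_norm_sub_lt` of `TateAlmostEtalePrincipalUnitRoots`).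

These are the residue-field inputs of the structure theorem for tamely ramified extensions of `K_∞`
(`TateTameStructure`), the last step of the tree's elementary proof of Tate's (TS1). No `sorry`, no
definitions.

References: J.-P. Serre, *Local Fields*, Ch. II §4 (multiplicative representatives), Ch. I §6–§7
[SerreLocalFields1979]; S. Lang, *Algebraic Number Theory*, Ch. II §4–§5 [LangANT1994];
J. Tate, *p-divisible groups* (1967) §3.2 [Tate1967].
-/

noncomputable section

open Polynomial IntermediateField Module ValuativeRel Field

namespace Literature.NumberTheory.PAdicHodge

namespace TateAlmostEtale

open Literature.NumberTheory.GaloisRepresentations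
open Literature.NumberTheory.GaloisRepresentations.IsNonarchimedeanLocalField

/-! ### §1 Stripping `p`-power exponents: `x^{p^a} ≡ 1 ⇒ x ≡ 1` -/

section Strip

variable {E : Type*} [NormedField E] [IsUltrametricDist E]

omit [IsUltrametricDist E] in
/-- `‖(-1)^p + 1‖ ≤ ‖p‖` for a prime `p` (zero for odd `p`, `‖2‖` for `p = 2`). [folklore] -/
private theorem norm_neg_one_pow_add_one_le {p : ℕ} (hp : p.Prime) :
    ‖(-1 : E) ^ p + 1‖ ≤ ‖(p : E)‖ := by
  rcases hp.eq_two_or_odd' with rfl | hodd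
  · norm_num
  · rw [hodd.neg_one_pow, neg_add_cancel, norm_zero]; exact norm_nonneg _

/-- **`x^p ≡ 1 ⇒ x ≡ 1` modulo the maximal ideal**: for `‖x‖ ≤ 1` in an ultrametric normed field with
`‖p‖ < 1`, `‖x^p - 1‖ < 1` implies `‖x - 1‖ < 1` (`(x-1)^p ≡ x^p - 1 (mod p)`, the residue ring having
characteristic `p`). [cite: SerreLocalFields1979, Ch. II §4 Prop. 8] -/
theorem norm_sub_one_lt_one_of_pow_prime {p : ℕ} (hp : p.Prime) (hq : ‖(p : E)‖ < 1) {x : E}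
    (hx : ‖x‖ ≤ 1) (h : ‖x ^ p - 1‖ < 1) : ‖x - 1‖ < 1 := by
  have h1 := norm_add_pow_sub_le hp x (-1) hx (by rw [norm_neg, norm_one])
  have hdec : (x - 1) ^ p = ((x + -1) ^ p - x ^ p - (-1) ^ p) + (x ^ p - 1) + ((-1) ^ p + 1) := by
    rw [← sub_eq_add_neg]; ring
  have hle : ‖(x - 1) ^ p‖ < 1 := by
    rw [hdec]
    refine lt_of_le_of_lt (IsUltrametricDist.norm_add_le_max _ _) (max_lt ?_ ?_)
    · exact lt_of_le_of_lt (IsUltrametricDist.norm_add_le_max _ _) (max_lt (h1.trans_lt hq) h)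
    · exact (norm_neg_one_pow_add_one_le hp).trans_lt hq
  rw [norm_pow] at hle
  exact (pow_lt_one_iff_of_nonneg (norm_nonneg _) hp.ne_zero).mp hle

/-- Iterated form: for `‖x‖ ≤ 1`, `‖x^{p^a} - 1‖ < 1 ⇒ ‖x - 1‖ < 1`.
[cite: SerreLocalFields1979, Ch. II §4 Prop. 8] -/
theorem norm_sub_one_lt_one_of_pow_prime_pow {p : ℕ} (hp : p.Prime) (hq : ‖(p : E)‖ < 1) {x : E}
    (hx : ‖x‖ ≤ 1) (a : ℕ) (h : ‖x ^ p ^ a - 1‖ < 1) : ‖x - 1‖ < 1 := by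
  induction a with
  | zero => simpa using h
  | succ a ih =>
    apply ih
    rw [pow_succ, pow_mul] at h
    exact norm_sub_one_lt_one_of_pow_prime hp hq (by rw [norm_pow]; exact pow_le_one₀ (norm_nonneg _) hx) h

/-- For `‖x‖ ≤ 1`: `‖x^c - 1‖ ≤ ‖x - 1‖`. [folklore] -/
private theorem norm_pow_sub_one_le' {x : E} (hx : ‖x‖ ≤ 1) (c : ℕ) : ‖x ^ c - 1‖ ≤ ‖x - 1‖ := by
  have h := norm_pow_sub_pow_le x 1 hx (by rw [norm_one]) c
  rwa [one_pow] at h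

end Strip

/-! ### §2 A unit of a finite extension of `ℚ_p` has `u^{N₀} ≡ 1 (mod p)` for some `0 < N₀ ≤ p^n` -/

variable {F : Type} [Field F] [ValuativeRel F] [TopologicalSpace F] [IsNonarchimedeanLocalField F]
  [CharZero F] {p : ℕ} [Fact p.Prime] (hp : valuation F p < 1)

section Exponent

variable (M : IntermediateField (PadicBase F p hp) (NormedAlgClosure F))
  [FiniteDimensional (PadicBase F p hp) M]

/-- The minimal polynomial over `K₀` of an element of `F̄` of norm `≤ 1` has coefficients of norm `≤ 1`
(it splits over `F̄` with isometric `G₀`-conjugate roots). [cite: SerreLocalFields1979, Ch. II §2 Prop. 3] -/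
theorem norm_coeff_minpoly_base_le_one {u : NormedAlgClosure F} (hu : ‖u‖ ≤ 1) (i : ℕ) :
    ‖algebraMap (PadicBase F p hp) (NormedAlgClosure F) ((minpoly (PadicBase F p hp) u).coeff i)‖ ≤ 1 := by
  have hint : IsIntegral (PadicBase F p hp) u := Algebra.IsIntegral.isIntegral u
  set P' : (NormedAlgClosure F)[X] :=
    (minpoly (PadicBase F p hp) u).map (algebraMap (PadicBase F p hp) (NormedAlgClosure F)) with hP'
  have hsp : P'.Splits := IsAlgClosed.splits P'
  have hmo : P'.Monic := (minpoly.monic hint).map _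
  have heq : P' = (P'.roots.map (X - C ·)).prod := hsp.eq_prod_roots_of_monic hmo
  have hroots : ∀ r ∈ P'.roots, ‖r‖ ≤ 1 := by
    intro r hr
    rw [BaseGaloisGroup.norm_eq_of_mem_aroots hp u r hr]; exact hu
  have h := norm_coeff_prod_X_sub_C_le P'.roots zero_le_one hroots i
  rw [← heq, one_pow, hP', coeff_map] at h
  exact h

/-- **`u^{N₀} ≡ 1 (mod p)` for a unit of a finite extension of `ℚ_p`.** For `u ∈ M`, `‖u‖ = 1`,
`n = [M : K₀]`: some `0 < N₀ ≤ p^n` has `‖u^{N₀} - 1‖ ≤ ‖p‖`. Proof: the minimal polynomial `g` of `u`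
over `K₀` has coefficients in `ℤ_p` and degree `k ≤ n`; its reduction `ḡ ∈ 𝔽_p[X]` defines the finite
ring `𝔽_p[X]/(ḡ)` with `p^k` elements, in which two of the powers `x^0, …, x^{p^k}` of the class `x` of
`X` agree, `x^i = x^j` (`i < j`): `ḡ ∣ X^i (X^{j-i} - 1)`. Lifting the cofactor to `ℤ_p[X]`,
`X^i (X^{j-i} - 1) = g h + p r` in `ℤ_p[X]`, and evaluating at `u`: `‖u^i (u^{j-i} - 1)‖ ≤ ‖p‖`.
[cite: SerreLocalFields1979, Ch. II §4 Prop. 8, Ch. I §6] [cite: LangANT1994, Ch. II §4] -/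
theorem exists_pow_sub_one_norm_le_of_norm_eq_one {u : NormedAlgClosure F} (huM : u ∈ M)
    (hu : ‖u‖ = 1) :
    ∃ N₀ : ℕ, 0 < N₀ ∧ N₀ ≤ p ^ finrank (PadicBase F p hp) M ∧
      ‖u ^ N₀ - 1‖ ≤ ‖(p : NormedAlgClosure F)‖ := by
  classical
  have hprime : p.Prime := Fact.out
  haveI : NeZero p := ⟨hprime.ne_zero⟩
  set K₀ := PadicBase F p hp
  set n : ℕ := finrank K₀ M with hn
  -- the minimal polynomial `g` of `u` over `K₀`: degree `k ≤ n`, integral coefficients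
  have hint : IsIntegral K₀ u := Algebra.IsIntegral.isIntegral u
  set g : K₀[X] := minpoly K₀ u with hg
  have hgmo : g.Monic := minpoly.monic hint
  set k : ℕ := g.natDegree with hk
  have hkn : k ≤ n := by
    have h1 : minpoly K₀ (⟨u, huM⟩ : M) = g := by
      rw [hg, ← minpoly.algHom_eq M.val Subtype.val_injective (⟨u, huM⟩ : M)]; rfl
    have h2 := minpoly.natDegree_le (A := K₀) (⟨u, huM⟩ : M)
    rwa [h1] at h2
  -- lift `g` to `g₀ ∈ ℤ_p[X]`
  have hlifts : g ∈ Polynomial.lifts (PadicBase.ofPadicInt hp) := by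
    rw [lifts_iff_coeff_lifts]
    intro i
    have hci : ‖g.coeff i‖ ≤ 1 := by
      rw [← PadicBase.norm_algebraMap_closure]; exact norm_coeff_minpoly_base_le_one hp hu.le i
    refine ⟨⟨PadicBase.toPadic hp (g.coeff i), (PadicBase.norm_le_one_iff hp _).mp hci⟩, ?_⟩
    rw [PadicBase.ofPadicInt_apply]
    change (PadicBase.toPadic hp).symm (PadicBase.toPadic hp (g.coeff i)) = g.coeff i
    rw [RingEquiv.symm_apply_apply]
  obtain ⟨g₀, hg₀map, hg₀deg, hg₀mo⟩ := lifts_and_natDegree_eq_and_monic hlifts hgmo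
  -- reduce modulo `p`: `ḡ ∈ 𝔽_p[X]`, the finite ring `A = 𝔽_p[X]/(ḡ)` of order `p^k`
  set gbar : (ZMod p)[X] := g₀.map (PadicInt.toZMod (p := p)) with hgbar
  have hgbarmo : gbar.Monic := hg₀mo.map _
  have hgbardeg : gbar.natDegree = k := by rw [hgbar, hg₀mo.natDegree_map, hg₀deg]
  haveI : Module.Finite (ZMod p) (AdjoinRoot gbar) := hgbarmo.finite_adjoinRoot
  haveI : Finite (AdjoinRoot gbar) := Module.finite_of_finite (ZMod p)
  letI : Fintype (AdjoinRoot gbar) := Fintype.ofFinite _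
  have hcard : Fintype.card (AdjoinRoot gbar) = p ^ k := by
    rw [Module.card_eq_pow_finrank (K := ZMod p), ZMod.card, (AdjoinRoot.powerBasis' hgbarmo).finrank,
      AdjoinRoot.powerBasis'_dim, hgbardeg]
  -- pigeonhole among `x^0, …, x^{p^k}`
  obtain ⟨i, j, hij, hxij⟩ := Fintype.exists_ne_map_eq_of_card_lt
    (fun i : Fin (p ^ k + 1) => (AdjoinRoot.root gbar) ^ (i : ℕ)) (by rw [hcard, Fintype.card_fin]; omega)
  -- wlog `i < j`
  have key : ∀ i j : ℕ, i < j → j ≤ p ^ k →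
      (AdjoinRoot.root gbar) ^ i = (AdjoinRoot.root gbar) ^ j →
      ∃ N₀ : ℕ, 0 < N₀ ∧ N₀ ≤ p ^ n ∧ ‖u ^ N₀ - 1‖ ≤ ‖(p : NormedAlgClosure F)‖ := by
    intro i j hlt hjle hx
    -- `ḡ ∣ X^i (X^{j-i} - 1)`
    have hdvd : gbar ∣ X ^ i * (X ^ (j - i) - 1) := by
      have h1 : AdjoinRoot.mk gbar (X ^ j) = AdjoinRoot.mk gbar (X ^ i) := by
        rw [map_pow, map_pow, AdjoinRoot.mk_X]; exact hx.symm
      rw [AdjoinRoot.mk_eq_mk] at h1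
      have h2 : (X : (ZMod p)[X]) ^ j - X ^ i = X ^ i * (X ^ (j - i) - 1) := by
        rw [mul_sub, mul_one, ← pow_add, Nat.add_sub_cancel' hlt.le]
      rwa [h2] at h1
    obtain ⟨hbar, hhbar⟩ := hdvd
    obtain ⟨h₀, hh₀⟩ := Polynomial.map_surjective (PadicInt.toZMod (p := p))
      (ZMod.ringHom_surjective _) hbar
    -- `r₀ = X^i (X^{j-i} - 1) - g₀ h₀ ∈ p ℤ_p[X]`
    set r₀ : ℤ_[p][X] := X ^ i * (X ^ (j - i) - 1) - g₀ * h₀ with hr₀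
    have hr₀map : r₀.map (PadicInt.toZMod (p := p)) = 0 := by
      rw [hr₀, Polynomial.map_sub, Polynomial.map_mul, Polynomial.map_mul, Polynomial.map_pow,
        Polynomial.map_sub, Polynomial.map_pow, map_X, Polynomial.map_one, ← hgbar, hh₀, ← hhbar, sub_self]
    have hr₀mem : r₀ ∈ (Ideal.span {(p : ℤ_[p])}).map (C : ℤ_[p] →+* ℤ_[p][X]) := by
      rw [Ideal.mem_map_C_iff]
      intro m
      rw [← PadicInt.maximalIdeal_eq_span_p, ← PadicInt.ker_toZMod, RingHom.mem_ker, ← coeff_map, hr₀map,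
        coeff_zero]
    rw [Ideal.map_span, Set.image_singleton, Ideal.mem_span_singleton'] at hr₀mem
    obtain ⟨r₁, hr₁⟩ := hr₀mem
    -- evaluate at `u`
    set φ : ℤ_[p] →+* NormedAlgClosure F := (algebraMap K₀ (NormedAlgClosure F)).comp (PadicBase.ofPadicInt hp)
      with hφ
    have hg₀u : eval₂ φ u g₀ = 0 := by
      rw [hφ, ← eval₂_map, hg₀map, hg, ← aeval_def, minpoly.aeval]
    have hevalr₀ : eval₂ φ u r₀ = u ^ i * (u ^ (j - i) - 1) := by
      rw [hr₀, eval₂_sub, eval₂_mul, eval₂_mul, hg₀u, zero_mul, sub_zero, eval₂_pow, eval₂_X, eval₂_sub,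
        eval₂_pow, eval₂_X, eval₂_one]
    have hevalr₀' : eval₂ φ u r₀ = eval₂ φ u r₁ * (p : NormedAlgClosure F) := by
      rw [← hr₁, eval₂_mul, eval₂_C, hφ, RingHom.comp_apply, map_natCast, map_natCast]
    have hr₁le : ‖eval₂ φ u r₁‖ ≤ 1 := by
      rw [eval₂_eq_sum_range]
      refine IsUltrametricDist.norm_sum_le_of_forall_le_of_nonneg zero_le_one fun m _ => ?_
      rw [norm_mul, norm_pow, hu, one_pow, mul_one, hφ, RingHom.comp_apply,
        PadicBase.norm_algebraMap_closure]
      exact PadicBase.norm_ofPadicInt_le_one hp _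
    refine ⟨j - i, Nat.sub_pos_of_lt hlt, ?_, ?_⟩
    · calc j - i ≤ j := Nat.sub_le j i
        _ ≤ p ^ k := hjle
        _ ≤ p ^ n := Nat.pow_le_pow_right hprime.pos hkn
    · have h3 : ‖u ^ i * (u ^ (j - i) - 1)‖ = ‖u ^ (j - i) - 1‖ := by
        rw [norm_mul, norm_pow, hu, one_pow, one_mul]
      rw [← h3, ← hevalr₀, hevalr₀', norm_mul]
      exact mul_le_of_le_one_left (norm_nonneg _) hr₁le
  have hi : (i : ℕ) ≤ p ^ k := Nat.lt_succ_iff.mp i.2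
  have hj : (j : ℕ) ≤ p ^ k := Nat.lt_succ_iff.mp j.2
  rcases lt_or_gt_of_ne (Fin.val_ne_of_ne hij) with hlt | hgt
  · exact key i j hlt hj hxij
  · exact key j i hgt hi hxij.symm

/-- **The `p`-free form**: every unit `u ∈ M` has `‖u^{N'} - 1‖ < 1` for some `0 < N' ≤ p^n` with
`p ∤ N'` (write `N₀ = p^a N'` and strip the `p`-power with `norm_sub_one_lt_one_of_pow_prime_pow`).
[cite: SerreLocalFields1979, Ch. II §4 Prop. 8] -/
theorem exists_pow_sub_one_norm_lt_of_norm_eq_one {u : NormedAlgClosure F} (huM : u ∈ M)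
    (hu : ‖u‖ = 1) :
    ∃ N' : ℕ, 0 < N' ∧ N' ≤ p ^ finrank (PadicBase F p hp) M ∧ ¬ p ∣ N' ∧ ‖u ^ N' - 1‖ < 1 := by
  have hprime : p.Prime := Fact.out
  have hq1 : ‖(p : NormedAlgClosure F)‖ < 1 := by
    rw [PadicBase.norm_natCast_closure hp]; exact PadicBase.norm_p_lt_one hp
  obtain ⟨N₀, hN₀pos, hN₀le, hN₀⟩ := exists_pow_sub_one_norm_le_of_norm_eq_one hp M huM hu
  obtain ⟨a, N', hN', hN₀eq⟩ := Nat.exists_eq_pow_mul_and_not_dvd hN₀pos.ne' p hprime.ne_one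
  have hN'pos : 0 < N' := by
    rcases Nat.eq_zero_or_pos N' with h | h
    · rw [h, mul_zero] at hN₀eq; omega
    · exact h
  refine ⟨N', hN'pos, ?_, hN', ?_⟩
  · calc N' ≤ p ^ a * N' := Nat.le_mul_of_pos_left N' (pow_pos hprime.pos a)
      _ = N₀ := hN₀eq.symm
      _ ≤ _ := hN₀le
  · apply norm_sub_one_lt_one_of_pow_prime_pow hprime hq1 (x := u ^ N')
      (by rw [norm_pow, hu, one_pow]) a
    rw [← pow_mul, mul_comm, ← hN₀eq]
    exact hN₀.trans_lt hq1

/-- **A uniform exponent prime to `p`.** For `M` finite over `K₀` there is `N > 0`, `p ∤ N`, with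
`‖u^N - 1‖ < 1` for EVERY `u ∈ M` with `‖u‖ = 1` (the product of all `N' ≤ p^{[M:K₀]}` prime to `p`):
the unit group of the residue field of `M` is finite of order prime to `p`.
[cite: SerreLocalFields1979, Ch. II §4 Prop. 8, Ch. I §6] [cite: LangANT1994, Ch. II §4] -/
theorem exists_uniform_exponent :
    ∃ N : ℕ, 0 < N ∧ ¬ p ∣ N ∧ ∀ u ∈ M, ‖u‖ = 1 → ‖u ^ N - 1‖ < 1 := by
  classical
  have hprime : p.Prime := Fact.out
  set n : ℕ := finrank (PadicBase F p hp) M with hn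
  set S : Finset ℕ := (Finset.Icc 1 (p ^ n)).filter (fun j => ¬ p ∣ j) with hS
  refine ⟨∏ j ∈ S, j, ?_, ?_, ?_⟩
  · exact Finset.prod_pos fun j hj => by
      rw [hS, Finset.mem_filter, Finset.mem_Icc] at hj; omega
  · rw [Prime.dvd_finsetProd_iff hprime.prime]
    rintro ⟨j, hj, hpj⟩
    rw [hS, Finset.mem_filter] at hj
    exact hj.2 hpj
  · intro u huM hu
    obtain ⟨N', hN'pos, hN'le, hN', hlt⟩ := exists_pow_sub_one_norm_lt_of_norm_eq_one hp M huM hu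
    have hmem : N' ∈ S := by
      rw [hS, Finset.mem_filter, Finset.mem_Icc]; exact ⟨⟨hN'pos, hN'le⟩, hN'⟩
    obtain ⟨c, hc⟩ := Finset.dvd_prod_of_mem (fun j => j) hmem
    rw [hc, pow_mul]
    exact (norm_pow_sub_one_le' (by rw [norm_pow, hu, one_pow]) c).trans_lt hlt

/-- **Teichmüller representatives in a finite extension of `ℚ_p` inside `F̄`.** There is `N > 0`,
`p ∤ N`, such that every `u ∈ M` with `‖u‖ = 1` is within distance `< 1` of a root of unity `ω ∈ M`
with `ω^N = 1` (uniform exponent + the Hensel-free lifting `exists_rootOfUnity_norm_sub_lt`). The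
residues of the units of `M` are represented by the `N`-th roots of unity in `M`.
[cite: SerreLocalFields1979, Ch. II §4 Prop. 8] [cite: LangANT1994, Ch. II §4] -/
theorem exists_teichmuller :
    ∃ N : ℕ, 0 < N ∧ ¬ p ∣ N ∧ ∀ u ∈ M, ‖u‖ = 1 → ∃ ω ∈ M, ω ^ N = 1 ∧ ‖u - ω‖ < 1 := by
  obtain ⟨N, hN0, hN, h⟩ := exists_uniform_exponent hp M
  exact ⟨N, hN0, hN, fun u huM hu => exists_rootOfUnity_norm_sub_lt hp M hN hN0.ne' huM (h u huM hu)⟩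

end Exponent

end TateAlmostEtale

end Literature.NumberTheory.PAdicHodge

end
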